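import Summits.CriticalPhenomena.PercolationContinuityZ3.Theorems.PercNearOneGluingNoHeavyLowerTailAPLGluedClusters
import HarnessLib

/-!
# `NoHeavyLowerTail` (stmt-CriticalPhenomena-4575) — the graph ↔ cells dictionary, V: splitting an edge set at the apex

Support file (prover prim-ineq-gen-8 gen 36; `--supports stmt-CriticalPhenomena-4575`; memo
run/shared/lean/prim/prim-ineq-gen-8/FINDING-gen36-LEMMA-U.md §5, step (D4)).  Pure combinatorics: no definitions, no named facts, no sorries.

SETTING.  An edge set `D : Finset (Sym2 V)`, terminals `a, b, c`, and a non-terminal neighbour `g` of the apex `a`.  With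
`D₀ := D.filter (a ∉ · ∧ b ∉ · ∧ c ∉ ·)` (terminal-free edges), `R := cl D₀ g` (vertices reachable from `g` avoiding the terminals),
THE PIECE THROUGH `g` is `G₁ := D.filter (∃ v ∈ R, v ∈ ·)` and THE REST is `H := D.filter (¬ ∃ v ∈ R, v ∈ ·)` (all written out; no definitions).
* `apexSplit_union`, `apexSplit_disjoint`, `apexSplit_mem` — `G₁ ∪ H = D`, disjoint, `s(a,g) ∈ G₁`;
* `apexSplit_not_mem_R` — terminals are not in `R`;
* `apexSplit_glued` — `G₁` and `H` are glued only at the terminals (no loops in `D`): the gluing hypothesis of `glued_cell_*`;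
* `apexSplit_apex_edge` — if the forest-part edge `s(a,g)` is a BRIDGE of the forest part `F := D.filter (b ∉ · ∧ c ∉ ·)` (true when `F` is
  acyclic), every edge of `G₁` at `a` is `s(a,g)`; so either `H ≠ ∅` and `D = G₁ ⊔ H` is a proper gluing, or `a` is pendant in `D = G₁`
  (`pendant_cell_*`).  This is the decomposition step of THEOREM F_T's induction (memo gen 34 §2).
[folklore]
-/

namespace Summit.CriticalPhenomena.PercolationContinuityZ3.Theorems

namespace APL

open Literature.Probability.Percolation Literature.Probability.Percolation.Gladkov
open scoped Classical

variable {V : Type*} [Fintype V] [DecidableEq V]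

/-- The piece through `g` and the rest partition `D`. [folklore] -/
theorem apexSplit_union (D : Finset (Sym2 V)) (a b c g : V) :
    (D.filter fun f => ∃ v ∈ (cl (D.filter fun f => a ∉ f ∧ b ∉ f ∧ c ∉ f) g), v ∈ f) ∪ (D.filter fun f => ¬ ∃ v ∈ (cl (D.filter fun f => a ∉ f ∧ b ∉ f ∧ c ∉ f) g), v ∈ f) = D :=
  Finset.filter_union_filter_not_eq _ D

/-- The piece through `g` and the rest are disjoint. [folklore] -/
theorem apexSplit_disjoint (D : Finset (Sym2 V)) (a b c g : V) :
    Disjoint (D.filter fun f => ∃ v ∈ (cl (D.filter fun f => a ∉ f ∧ b ∉ f ∧ c ∉ f) g), v ∈ f) (D.filter fun f => ¬ ∃ v ∈ (cl (D.filter fun f => a ∉ f ∧ b ∉ f ∧ c ∉ f) g), v ∈ f) :=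
  Finset.disjoint_filter_filter_not D D _

/-- The apex edge `s(a,g)` lies in the piece through `g`. [folklore] -/
theorem apexSplit_mem (D : Finset (Sym2 V)) (a b c g : V) (he : s(a, g) ∈ D) :
    s(a, g) ∈ (D.filter fun f => ∃ v ∈ (cl (D.filter fun f => a ∉ f ∧ b ∉ f ∧ c ∉ f) g), v ∈ f) :=
  Finset.mem_filter.2 ⟨he, g, mem_cl_self _ _, Sym2.mem_mk_right _ _⟩

/-- No terminal is reachable from the non-terminal `g` through terminal-free edges. [folklore] -/
theorem apexSplit_not_mem_R (D : Finset (Sym2 V)) (a b c g : V) (hga : g ≠ a) (hgb : g ≠ b) (hgc : g ≠ c)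
    {t : V} (ht : t = a ∨ t = b ∨ t = c) : t ∉ (cl (D.filter fun f => a ∉ f ∧ b ∉ f ∧ c ∉ f) g) := fun h => by
  have htg : t ≠ g := by rcases ht with rfl | rfl | rfl <;> [exact hga.symm; exact hgb.symm; exact hgc.symm]
  obtain ⟨f, hf, htf⟩ := exists_mem_edge_of_mem_cl h htg
  have hf' := (Finset.mem_filter.1 hf).2
  rcases ht with rfl | rfl | rfl
  · exact hf'.1 htf
  · exact hf'.2.1 htf
  · exact hf'.2.2 htf

/-- **Gluing**: a vertex meeting an edge of the piece through `g` and an edge of the rest is a terminal (no loops in `D`). [folklore] -/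
theorem apexSplit_glued (D : Finset (Sym2 V)) (a b c g : V) (hga : g ≠ a) (hgb : g ≠ b) (hgc : g ≠ c) :
    ∀ v : V, (∃ f ∈ (D.filter fun f => ∃ v ∈ (cl (D.filter fun f => a ∉ f ∧ b ∉ f ∧ c ∉ f) g), v ∈ f), v ∈ f) → (∃ f ∈ (D.filter fun f => ¬ ∃ v ∈ (cl (D.filter fun f => a ∉ f ∧ b ∉ f ∧ c ∉ f) g), v ∈ f), v ∈ f) → (v = a ∨ v = b ∨ v = c) := by
  rintro v ⟨f₁, hf₁, hv₁⟩ ⟨f₂, hf₂, hv₂⟩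
  by_contra hv
  have hva : v ≠ a := fun h => hv (Or.inl h)
  have hvb : v ≠ b := fun h => hv (Or.inr (Or.inl h))
  have hvc : v ≠ c := fun h => hv (Or.inr (Or.inr h))
  obtain ⟨hf₁D, r, hr, hrf⟩ := Finset.mem_filter.1 hf₁
  obtain ⟨hf₂D, hno⟩ := Finset.mem_filter.1 hf₂
  have hvR : v ∉ (cl (D.filter fun f => a ∉ f ∧ b ∉ f ∧ c ∉ f) g) := fun h => hno ⟨v, h, hv₂⟩
  have hrv : r ≠ v := fun h => hvR (h ▸ hr)
  have hf₁eq : f₁ = s(r, v) := (Sym2.mem_and_mem_iff hrv).1 ⟨hrf, hv₁⟩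
  -- `r` is not a terminal either
  have hra : r ≠ a := fun h => apexSplit_not_mem_R D a b c g hga hgb hgc (Or.inl h) hr
  have hrb : r ≠ b := fun h => apexSplit_not_mem_R D a b c g hga hgb hgc (Or.inr (Or.inl h)) hr
  have hrc : r ≠ c := fun h => apexSplit_not_mem_R D a b c g hga hgb hgc (Or.inr (Or.inr h)) hr
  -- so `f₁` is terminal-free, and `v` is adjacent to `r` through it
  have hf₁0 : s(r, v) ∈ (D.filter fun f => a ∉ f ∧ b ∉ f ∧ c ∉ f) := by
    refine Finset.mem_filter.2 ⟨hf₁eq ▸ hf₁D, ?_, ?_, ?_⟩ <;> rw [Sym2.mem_iff, not_or]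
    · exact ⟨hra.symm, hva.symm⟩
    · exact ⟨hrb.symm, hvb.symm⟩
    · exact ⟨hrc.symm, hvc.symm⟩
  exact hvR (mem_cl_of_adj hr (adj_iff.2 ⟨hf₁0, hrv⟩))

/-- **The apex edge is the only edge of the piece at `a`**, provided `s(a,g)` is a bridge of the forest part
`F = D.filter (b ∉ · ∧ c ∉ ·)` (i.e. `a` and `g` are not joined in `F` minus that edge — automatic when `F` is acyclic); the gluing itself (`apexSplit_glued`)
needs no acyclicity. [folklore] -/
theorem apexSplit_apex_edge (D : Finset (Sym2 V)) (a b c g : V) (hab : a ≠ b) (hac : a ≠ c) (hga : g ≠ a) (hgb : g ≠ b) (hgc : g ≠ c)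
    (hbridge : ¬ (openGraph (↑((D.filter fun f => b ∉ f ∧ c ∉ f).erase s(a, g)) : Set (Sym2 V))).Reachable a g) :
    ∀ f ∈ (D.filter fun f => ∃ v ∈ (cl (D.filter fun f => a ∉ f ∧ b ∉ f ∧ c ∉ f) g), v ∈ f), a ∈ f → f = s(a, g) := by
  intro f hf haf
  obtain ⟨hfD, r, hr, hrf⟩ := Finset.mem_filter.1 hf
  have hra : r ≠ a := fun h => apexSplit_not_mem_R D a b c g hga hgb hgc (Or.inl h) hr
  have hfeq : f = s(a, r) := (Sym2.mem_and_mem_iff hra.symm).1 ⟨haf, hrf⟩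
  by_contra hne
  have hrg : r ≠ g := fun h => hne (by rw [hfeq, h])
  apply hbridge
  -- `g ↔ r` through terminal-free edges, all in `F.erase s(a,g)`
  have hsub : (D.filter fun f => a ∉ f ∧ b ∉ f ∧ c ∉ f) ⊆ (D.filter fun f => b ∉ f ∧ c ∉ f).erase s(a, g) := by
    intro e he
    obtain ⟨heD, hea, heb, hec⟩ := Finset.mem_filter.1 he
    refine Finset.mem_erase.2 ⟨fun h => hea (h ▸ Sym2.mem_mk_left _ _), Finset.mem_filter.2 ⟨heD, heb, hec⟩⟩
  have h1 : (openGraph (↑((D.filter fun f => b ∉ f ∧ c ∉ f).erase s(a, g)) : Set (Sym2 V))).Reachable g r :=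
    (mem_cl.1 hr).mono (openGraph_mono (Finset.coe_subset.2 hsub))
  -- and the edge `s(a,r)` is in `F.erase s(a,g)` too
  have h2 : s(a, r) ∈ (D.filter fun f => b ∉ f ∧ c ∉ f).erase s(a, g) := by
    refine Finset.mem_erase.2 ⟨fun h => hrg ?_, Finset.mem_filter.2 ⟨hfeq ▸ hfD, ?_, ?_⟩⟩
    · rcases Sym2.eq_iff.1 h with ⟨_, h⟩ | ⟨_, h⟩
      · exact h
      · exact absurd h hra
    · rw [Sym2.mem_iff, not_or]; exact ⟨hab.symm, fun h => apexSplit_not_mem_R D a b c g hga hgb hgc (Or.inr (Or.inl h.symm)) hr⟩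
    · rw [Sym2.mem_iff, not_or]; exact ⟨hac.symm, fun h => apexSplit_not_mem_R D a b c g hga hgb hgc (Or.inr (Or.inr h.symm)) hr⟩
  have hswap : s(r, a) = s(a, r) := Sym2.eq_swap
  have h3 : (openGraph (↑((D.filter fun f => b ∉ f ∧ c ∉ f).erase s(a, g)) : Set (Sym2 V))).Adj r a := adj_iff.2 ⟨by rw [hswap]; exact h2, hra⟩
  exact (h1.trans h3.reachable).symm

end APL

end Summit.CriticalPhenomena.PercolationContinuityZ3.Theorems
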